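import Summits.CriticalPhenomena.PercolationContinuityZ3.Theorems.PercNearOneGluingNoHeavyLowerTailPivotalDualRowsRandomCluster
import Summits.CriticalPhenomena.PercolationContinuityZ3.Theorems.PercNearOneGluingNoHeavyLowerTailConditionedBHKRandomCluster
import Summits.CriticalPhenomena.PercolationContinuityZ3.Theorems.PercNearOneGluingNoHeavyLowerTailRefinedRowR2FourFunctions
import Mathlib.Tactic.Linarith
import HarnessLib

/-!
# `NoHeavyLowerTail` (stmt-CriticalPhenomena-4575) — the SEPARATION ↔ PIVOTALITY dictionary: R3 and R4⁺ follow from R1 by the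
# dual-row chains, for EVERY random-cluster measure `φ_{𝐩,q}`, `q ≥ 1`

Support file (prover prim-gen-kcluster gen 50; `--supports stmt-CriticalPhenomena-4575`).  No named facts, no sorries, no definitions.

THE DICTIONARY (KCLUSTER-gen50 of run/shared/lean/prim/prim-gen-kcluster/).  On the T-side the lineage's rows live on the atoms of the
three increasing PIVOTAL events `H_a = {b ↔ c off a}`, `H_b`, `H_c` (atoms `T₀ = H_aH_bH_c`, `T_a = ¬H_a H_b H_c`, `u_a = H_a ¬H_b ¬H_c`,
`q = ¬H_a¬H_b¬H_c`; parts V–VIII and `…PivotalDualRowsRandomCluster`).  On the S-side take the three increasing SEPARATION events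
`Sep_a = {the cluster of a meets every b–c path of the support D}` (`RefinedRowR3.Sep D (cl ω a) b c`; it contains `{a↔b} ∪ {a↔c}`),
`Sep_b`, `Sep_c`, and their decreasing complements `K_x = ¬Sep_x`.  The atoms of `(K_a, K_b, K_c)` are EXACTLY the refined cells:
`K_aK_bK_c = B_0`, `¬K_a K_b K_c = S_a`, `K_a ¬K_b ¬K_c = U_a`, `¬K_a¬K_b¬K_c = T` (inside the support; `RefinedRowR3.not_sep_sep`),
i.e. `H_x ↦ K_x` sends `T₀ ↦ b₀`, `T_x ↦ s_x`, `u_x ↦ u_x`, `q ↦ t`, hence BHK row `q·T_a ≤ u_b u_c` ↦ R1 `t·s_a ≤ u_b u_c`,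
dR2 ↦ R2, dR3 `T_aT_b ≤ u_cT₀` ↦ R3 `s_a s_b ≤ u_c b₀`, dR4⁺ ↦ R4⁺ `s_a(u_a+s_c) ≤ u_b(b₀+s_b)`, and "given `H_c`, `H_a,H_b` positively
correlated" ↦ "given `¬Sep_c`, `¬Sep_a, ¬Sep_b` positively correlated".  Since the `K_x` are monotone, every FKG input of the
T-side chains (`dualRowR3_real`, `dualRowR4_real`, gen 44) is available on the S-side for any FKG measure, and the chains give:

* `sepDual_inputs_rcMeasureW` — the four FKG inequalities for `K_a, K_b, K_c` under `φ = rcMeasureW w q ∅`, `q ≥ 1`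
  (`ConditionedBHK.rc_fkg_lower`, `rc_fkg_upper_lower`); `isUpperSet_sepEvent` (monotonicity of `Sep` along configurations).
* **`r3_of_r1_rcMeasureW`** — for `φ = rcMeasureW w q ∅`, `q ≥ 1`: R1 at `a` and at `b` (in atom form) ⟹ R3 `φ(S_a)·φ(S_b) ≤ φ(U_c)·φ(B_0)`;
  equivalently **`posCorrSep_of_r1_rcMeasureW`**: given `¬Sep_c`, the events `¬Sep_a` and `¬Sep_b` are positively correlated.
* **`r4plus_of_r1_rcMeasureW`** — R1 at `a` ⟹ R4⁺ `φ(S_a)·(φ(U_a) + φ(S_c)) ≤ φ(U_b)·(φ(B_0) + φ(S_b))`.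
(Shorter certificates than the chains exist: `t·R3 = u_c·R2(a) + s_a·R1(b)` and `q·dR3 = u_c·dR2(a) + T_a·BHK(b)`; the file
reuses the landed chains instead.)

CONSEQUENCE for the q-deformation table (KCLUSTER-gen46 §3.3): with R2 an FKG-lattice theorem (`RefinedRowR2.r2_of_latticeCondition`,
this gen), the whole S-side column for `φ_{𝐩,q}`, `q ≥ 1`, reduces to ONE statement, **R1 for `φ_{𝐩,q}`** ("RC dual BHK", conjecture
RC-R1 of KCLUSTER-gen33, census-clean): R3, R4⁺ (and their conditional forms) are then theorems by this file.  At `q = 1` R1 is the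
kernel theorem `DualBHK.dualBHK` / `RefinedRowR1.r1_PrW`, so this file is also a second proof of R3/R4⁺ there (the first: the
Gladkov–Zimin exchanges of `…RefinedRowR3Switching`, `…RefinedRowR4PlusSwitching`).
[cite: VandenbergHaggstromKahn2005, Thm. 1.4 (p. 7) (pattern of the chains); Grimmett2006, Thm. (3.8) (FKG for `φ_{p,q}`)]
-/

noncomputable section

namespace Summit.CriticalPhenomena.PercolationContinuityZ3.Theorems

namespace SepDual

open Literature.Probability.Percolation Literature.Probability.Percolation.Gladkov
open MeasureTheory Literature.Probability.LatticeModels ThreePointLB RefinedRowR3 PivotalBHK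
open scoped Classical

variable {V : Type*} [Fintype V] [DecidableEq V]

/-! ### Monotonicity of the separation events -/

/-- Separation by the cluster of `x` is monotone in the configuration (bigger cluster, fewer avoiding paths). [this work] -/
theorem sep_mono_config {D X Y : Finset (Sym2 V)} (hXY : X ⊆ Y) {x y z : V} (h : Sep D (cl X x) y z) :
    Sep D (cl Y x) y z :=
  h.mono (cl_mono hXY x)

/-- The separation event `{ω | Sep D (cl ω x) y z}` is increasing. [this work] -/
theorem isUpperSet_sepEvent (D : Finset (Sym2 V)) (x y z : V) :
    IsUpperSet {ω : BondConfig V | Sep D (cl ω.toFinset x) y z} := by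
  intro ω ω' hle hω
  exact sep_mono_config (Set.toFinset_subset_toFinset.mpr hle) hω

/-- The non-separation event `{ω | ¬ Sep D (cl ω x) y z}` is decreasing. [this work] -/
theorem isLowerSet_nonSepEvent (D : Finset (Sym2 V)) (x y z : V) :
    IsLowerSet {ω : BondConfig V | ¬ Sep D (cl ω.toFinset x) y z} :=
  (isUpperSet_sepEvent D x y z).compl

/-! ### The FKG inputs for the three non-separation events -/

/-- **FKG inputs of the S-side chains** for `φ = rcMeasureW w q ∅`, `q ≥ 1`, with `K_a = ¬Sep_a`, `K_b = ¬Sep_b`, `K_c = ¬Sep_c`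
(decreasing): `φ(¬K_a K_b)·φ(K_a ¬K_b) ≤ φ(K_aK_b)·φ(¬K_a¬K_b)`, `φ(K_c ¬K_a) ≤ φ(K_c)·φ(¬K_a)`, `φ(K_c)·φ(K_aK_b) ≤ φ(K_aK_bK_c)`,
`φ(K_c)·φ(K_a) ≤ φ(K_aK_c)` — the S-side images of the Harris inputs of `PivotalBHK.dualRow_inputs_rcMeasureW`.
[cite: Grimmett2006, Thm. (3.8)] -/
theorem sepDual_inputs_rcMeasureW (D : Finset (Sym2 V)) (w : Sym2 V → unitInterval) {q : ℝ} (hq : 1 ≤ q)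
    (a b c : V) :
    let μ := rcMeasureW w q ∅
    let Ka : Set (BondConfig V) := {ω | ¬ Sep D (cl ω.toFinset a) b c}
    let Kb : Set (BondConfig V) := {ω | ¬ Sep D (cl ω.toFinset b) a c}
    let Kc : Set (BondConfig V) := {ω | ¬ Sep D (cl ω.toFinset c) a b}
    (μ.real (Kaᶜ ∩ Kb) * μ.real (Ka ∩ Kbᶜ) ≤ μ.real (Ka ∩ Kb) * μ.real (Kaᶜ ∩ Kbᶜ)) ∧
      (μ.real (Kc ∩ Kaᶜ) ≤ μ.real Kc * μ.real Kaᶜ) ∧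
      (μ.real Kc * μ.real (Ka ∩ Kb) ≤ μ.real (Ka ∩ Kb ∩ Kc)) ∧
      (μ.real Kc * μ.real Ka ≤ μ.real (Ka ∩ Kc)) := by
  intro μ Ka Kb Kc
  have hq0 : 0 < q := one_pos.trans_le hq
  haveI : IsProbabilityMeasure μ := isProbabilityMeasure_rcMeasureW w hq0 ∅
  have lA : IsLowerSet Ka := isLowerSet_nonSepEvent D a b c
  have lB : IsLowerSet Kb := isLowerSet_nonSepEvent D b a c
  have lC : IsLowerSet Kc := isLowerSet_nonSepEvent D c a b
  refine ⟨?_, ?_, ?_, ?_⟩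
  · -- AD form of the positive correlation of the two decreasing events `K_a`, `K_b`
    have h := ConditionedBHK.rc_fkg_lower w hq lA lB
    have sKa := KNGoodTwoMark.real_split μ Ka Kb
    have sKb : μ.real Kb = μ.real (Ka ∩ Kb) + μ.real (Kaᶜ ∩ Kb) := by
      rw [KNGoodTwoMark.real_split μ Kb Ka, Set.inter_comm Kb Ka, Set.inter_comm Kb Kaᶜ]
    have sKac := KNGoodTwoMark.real_split μ Kaᶜ Kb
    have total : μ.real Ka + μ.real Kaᶜ = 1 := by
      rw [probReal_compl_eq_one_sub (MeasurableSet.of_discrete)]; ring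
    change μ.real Ka * μ.real Kb ≤ μ.real (Ka ∩ Kb) at h
    rw [sKa, sKac] at total
    rw [sKa, sKb] at h
    have hx : μ.real (Ka ∩ Kb) * (μ.real (Ka ∩ Kb) + μ.real (Ka ∩ Kbᶜ) +
        (μ.real (Kaᶜ ∩ Kb) + μ.real (Kaᶜ ∩ Kbᶜ))) = μ.real (Ka ∩ Kb) := by
      rw [total, mul_one]
    nlinarith [h, hx]
  · have h := ConditionedBHK.rc_fkg_upper_lower w hq lA.compl lC
    rw [Set.inter_comm] at h
    rw [mul_comm]; exact h
  · have h := ConditionedBHK.rc_fkg_lower w hq lC (lA.inter lB)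
    have e : Kc ∩ (Ka ∩ Kb) = Ka ∩ Kb ∩ Kc := by ext ω; simp only [Set.mem_inter_iff]; tauto
    rw [e] at h; exact h
  · have h := ConditionedBHK.rc_fkg_lower w hq lC lA
    rw [Set.inter_comm] at h; exact h

/-! ### R3 from R1 (two apexes), for `φ_{𝐩,q}`, `q ≥ 1` -/

/-- **R3 ⟸ R1 for the random-cluster measure, every `q ≥ 1`.**  For `φ = rcMeasureW w q ∅` and the atoms of the separation
events `Sep_a, Sep_b, Sep_c` (`S_a = Sep_a ¬Sep_b ¬Sep_c`, `S_b = ¬Sep_a Sep_b ¬Sep_c`, `U_a = ¬Sep_a Sep_b Sep_c`, `U_b`, `U_c`,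
`T = Sep_a Sep_b Sep_c`, `B_0 = ¬Sep_a ¬Sep_b ¬Sep_c`): if R1 holds at `a` (`φ(T)·φ(S_a) ≤ φ(U_b)·φ(U_c)`) and at `b`
(`φ(T)·φ(S_b) ≤ φ(U_a)·φ(U_c)`), then R3 `φ(S_a)·φ(S_b) ≤ φ(U_c)·φ(B_0)`.  PROOF: the degree-four chain `dualRowR3_real` of the
T-side (part VI) fed with the two R1 rows in place of the BHK rows and FKG for the decreasing events `¬Sep_x`
(`sepDual_inputs_rcMeasureW`). [this work] -/
theorem r3_of_r1_rcMeasureW (D : Finset (Sym2 V)) (w : Sym2 V → unitInterval) {q : ℝ} (hq : 1 ≤ q) (a b c : V)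
    (hR1a : (rcMeasureW w q ∅).real {ω : BondConfig V | Sep D (cl ω.toFinset a) b c ∧
          Sep D (cl ω.toFinset b) a c ∧ Sep D (cl ω.toFinset c) a b} *
        (rcMeasureW w q ∅).real {ω : BondConfig V | Sep D (cl ω.toFinset a) b c ∧
          ¬ Sep D (cl ω.toFinset b) a c ∧ ¬ Sep D (cl ω.toFinset c) a b} ≤
      (rcMeasureW w q ∅).real {ω : BondConfig V | Sep D (cl ω.toFinset a) b c ∧
          ¬ Sep D (cl ω.toFinset b) a c ∧ Sep D (cl ω.toFinset c) a b} *
        (rcMeasureW w q ∅).real {ω : BondConfig V | Sep D (cl ω.toFinset a) b c ∧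
          Sep D (cl ω.toFinset b) a c ∧ ¬ Sep D (cl ω.toFinset c) a b})
    (hR1b : (rcMeasureW w q ∅).real {ω : BondConfig V | Sep D (cl ω.toFinset a) b c ∧
          Sep D (cl ω.toFinset b) a c ∧ Sep D (cl ω.toFinset c) a b} *
        (rcMeasureW w q ∅).real {ω : BondConfig V | ¬ Sep D (cl ω.toFinset a) b c ∧
          Sep D (cl ω.toFinset b) a c ∧ ¬ Sep D (cl ω.toFinset c) a b} ≤
      (rcMeasureW w q ∅).real {ω : BondConfig V | ¬ Sep D (cl ω.toFinset a) b c ∧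
          Sep D (cl ω.toFinset b) a c ∧ Sep D (cl ω.toFinset c) a b} *
        (rcMeasureW w q ∅).real {ω : BondConfig V | Sep D (cl ω.toFinset a) b c ∧
          Sep D (cl ω.toFinset b) a c ∧ ¬ Sep D (cl ω.toFinset c) a b}) :
    (rcMeasureW w q ∅).real {ω : BondConfig V | Sep D (cl ω.toFinset a) b c ∧
        ¬ Sep D (cl ω.toFinset b) a c ∧ ¬ Sep D (cl ω.toFinset c) a b} *
      (rcMeasureW w q ∅).real {ω : BondConfig V | ¬ Sep D (cl ω.toFinset a) b c ∧
        Sep D (cl ω.toFinset b) a c ∧ ¬ Sep D (cl ω.toFinset c) a b} ≤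
    (rcMeasureW w q ∅).real {ω : BondConfig V | Sep D (cl ω.toFinset a) b c ∧
        Sep D (cl ω.toFinset b) a c ∧ ¬ Sep D (cl ω.toFinset c) a b} *
      (rcMeasureW w q ∅).real {ω : BondConfig V | ¬ Sep D (cl ω.toFinset a) b c ∧
        ¬ Sep D (cl ω.toFinset b) a c ∧ ¬ Sep D (cl ω.toFinset c) a b} := by
  have hq0 : 0 < q := one_pos.trans_le hq
  haveI := isProbabilityMeasure_rcMeasureW w hq0 ∅
  obtain ⟨hH1, hH2, hH3, -⟩ := sepDual_inputs_rcMeasureW D w hq a b c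
  set μ := rcMeasureW w q ∅ with hμ
  set Ka : Set (BondConfig V) := {ω | ¬ Sep D (cl ω.toFinset a) b c} with hKa
  set Kb : Set (BondConfig V) := {ω | ¬ Sep D (cl ω.toFinset b) a c} with hKb
  set Kc : Set (BondConfig V) := {ω | ¬ Sep D (cl ω.toFinset c) a b} with hKc
  -- the statement's events as atoms
  have eT : {ω : BondConfig V | Sep D (cl ω.toFinset a) b c ∧ Sep D (cl ω.toFinset b) a c ∧
      Sep D (cl ω.toFinset c) a b} = Kaᶜ ∩ Kbᶜ ∩ Kcᶜ := by
    ext ω; simp only [Set.mem_inter_iff, Set.mem_compl_iff, hKa, hKb, hKc, Set.mem_setOf_eq, not_not]; tauto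
  have eSa : {ω : BondConfig V | Sep D (cl ω.toFinset a) b c ∧ ¬ Sep D (cl ω.toFinset b) a c ∧
      ¬ Sep D (cl ω.toFinset c) a b} = Kaᶜ ∩ Kb ∩ Kc := by
    ext ω; simp only [Set.mem_inter_iff, Set.mem_compl_iff, hKa, hKb, hKc, Set.mem_setOf_eq, not_not]; tauto
  have eSb : {ω : BondConfig V | ¬ Sep D (cl ω.toFinset a) b c ∧ Sep D (cl ω.toFinset b) a c ∧
      ¬ Sep D (cl ω.toFinset c) a b} = Ka ∩ Kbᶜ ∩ Kc := by
    ext ω; simp only [Set.mem_inter_iff, Set.mem_compl_iff, hKa, hKb, hKc, Set.mem_setOf_eq, not_not]; tauto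
  have eUa : {ω : BondConfig V | ¬ Sep D (cl ω.toFinset a) b c ∧ Sep D (cl ω.toFinset b) a c ∧
      Sep D (cl ω.toFinset c) a b} = Ka ∩ Kbᶜ ∩ Kcᶜ := by
    ext ω; simp only [Set.mem_inter_iff, Set.mem_compl_iff, hKa, hKb, hKc, Set.mem_setOf_eq, not_not]; tauto
  have eUb : {ω : BondConfig V | Sep D (cl ω.toFinset a) b c ∧ ¬ Sep D (cl ω.toFinset b) a c ∧
      Sep D (cl ω.toFinset c) a b} = Kaᶜ ∩ Kb ∩ Kcᶜ := by
    ext ω; simp only [Set.mem_inter_iff, Set.mem_compl_iff, hKa, hKb, hKc, Set.mem_setOf_eq, not_not]; tauto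
  have eUc : {ω : BondConfig V | Sep D (cl ω.toFinset a) b c ∧ Sep D (cl ω.toFinset b) a c ∧
      ¬ Sep D (cl ω.toFinset c) a b} = Kaᶜ ∩ Kbᶜ ∩ Kc := by
    ext ω; simp only [Set.mem_inter_iff, Set.mem_compl_iff, hKa, hKb, hKc, Set.mem_setOf_eq, not_not]; tauto
  have eB0 : {ω : BondConfig V | ¬ Sep D (cl ω.toFinset a) b c ∧ ¬ Sep D (cl ω.toFinset b) a c ∧
      ¬ Sep D (cl ω.toFinset c) a b} = Ka ∩ Kb ∩ Kc := by
    ext ω; simp only [Set.mem_inter_iff, hKa, hKb, hKc, Set.mem_setOf_eq]; tauto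
  rw [eT, eSa, eUb, eUc] at hR1a
  rw [eT, eSb, eUa, eUc] at hR1b
  rw [eSa, eSb, eUc, eB0]
  -- additivity over the atoms
  have sAc : μ.real Kaᶜ = μ.real (Kaᶜ ∩ Kb ∩ Kc) + μ.real (Kaᶜ ∩ Kb ∩ Kcᶜ) +
      (μ.real (Kaᶜ ∩ Kbᶜ ∩ Kc) + μ.real (Kaᶜ ∩ Kbᶜ ∩ Kcᶜ)) := by
    rw [KNGoodTwoMark.real_split μ Kaᶜ Kb, KNGoodTwoMark.real_split μ (Kaᶜ ∩ Kb) Kc,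
      KNGoodTwoMark.real_split μ (Kaᶜ ∩ Kbᶜ) Kc]
  have sAB : μ.real (Ka ∩ Kb) = μ.real (Ka ∩ Kb ∩ Kc) + μ.real (Ka ∩ Kb ∩ Kcᶜ) :=
    KNGoodTwoMark.real_split μ (Ka ∩ Kb) Kc
  have sAcB : μ.real (Kaᶜ ∩ Kb) = μ.real (Kaᶜ ∩ Kb ∩ Kc) + μ.real (Kaᶜ ∩ Kb ∩ Kcᶜ) :=
    KNGoodTwoMark.real_split μ (Kaᶜ ∩ Kb) Kc
  have sABc : μ.real (Ka ∩ Kbᶜ) = μ.real (Ka ∩ Kbᶜ ∩ Kc) + μ.real (Ka ∩ Kbᶜ ∩ Kcᶜ) :=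
    KNGoodTwoMark.real_split μ (Ka ∩ Kbᶜ) Kc
  have sAcBc : μ.real (Kaᶜ ∩ Kbᶜ) = μ.real (Kaᶜ ∩ Kbᶜ ∩ Kc) + μ.real (Kaᶜ ∩ Kbᶜ ∩ Kcᶜ) :=
    KNGoodTwoMark.real_split μ (Kaᶜ ∩ Kbᶜ) Kc
  have sCAc : μ.real (Kc ∩ Kaᶜ) = μ.real (Kaᶜ ∩ Kb ∩ Kc) + μ.real (Kaᶜ ∩ Kbᶜ ∩ Kc) := by
    rw [KNGoodTwoMark.real_split μ (Kc ∩ Kaᶜ) Kb]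
    have e1 : Kc ∩ Kaᶜ ∩ Kb = Kaᶜ ∩ Kb ∩ Kc := by ext ω; simp only [Set.mem_inter_iff]; tauto
    have e2 : Kc ∩ Kaᶜ ∩ Kbᶜ = Kaᶜ ∩ Kbᶜ ∩ Kc := by ext ω; simp only [Set.mem_inter_iff]; tauto
    rw [e1, e2]
  rw [sAcB, sABc, sAB, sAcBc] at hH1
  rw [sCAc, sAc] at hH2
  rw [sAB] at hH3
  exact dualRowR3_real (q := μ.real (Kaᶜ ∩ Kbᶜ ∩ Kcᶜ)) (ua := μ.real (Ka ∩ Kbᶜ ∩ Kcᶜ))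
    (ub := μ.real (Kaᶜ ∩ Kb ∩ Kcᶜ)) (uc := μ.real (Kaᶜ ∩ Kbᶜ ∩ Kc)) (Ta := μ.real (Kaᶜ ∩ Kb ∩ Kc))
    (Tb := μ.real (Ka ∩ Kbᶜ ∩ Kc)) (T0 := μ.real (Ka ∩ Kb ∩ Kc))
    (Z := μ.real (Ka ∩ Kb ∩ Kc) + μ.real (Ka ∩ Kb ∩ Kcᶜ)) (w := μ.real Kc)
    (nα := μ.real (Kaᶜ ∩ Kbᶜ ∩ Kcᶜ) + μ.real (Ka ∩ Kbᶜ ∩ Kcᶜ) + μ.real (Kaᶜ ∩ Kbᶜ ∩ Kc) +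
      μ.real (Ka ∩ Kbᶜ ∩ Kc))
    (nβ := μ.real (Kaᶜ ∩ Kbᶜ ∩ Kcᶜ) + μ.real (Kaᶜ ∩ Kb ∩ Kcᶜ) + μ.real (Kaᶜ ∩ Kbᶜ ∩ Kc) +
      μ.real (Kaᶜ ∩ Kb ∩ Kc))
    measureReal_nonneg measureReal_nonneg measureReal_nonneg measureReal_nonneg measureReal_nonneg
    measureReal_nonneg measureReal_nonneg (by positivity) hR1a hR1b rfl rfl
    (by linarith [hH1]) (by linarith [hH2]) hH3

/-- **Conditional form** (equivalent to R3 given R1): for `φ = rcMeasureW w q ∅`, `q ≥ 1`, if R1 holds at `a` and at `b` then,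
conditionally on `¬Sep_c` (the cluster of `c` does not separate `a` from `b`), the decreasing events `¬Sep_a` and `¬Sep_b` are
positively correlated: `φ(¬Sep_b ¬Sep_c)·φ(¬Sep_a ¬Sep_c) ≤ φ(¬Sep_c)·φ(¬Sep_a ¬Sep_b ¬Sep_c)` — the S-side image of
`PivotalBHK.posCorr_rcMeasureW`. [this work] -/
theorem posCorrSep_of_r1_rcMeasureW (D : Finset (Sym2 V)) (w : Sym2 V → unitInterval) {q : ℝ} (hq : 1 ≤ q) (a b c : V)
    (hR1a : (rcMeasureW w q ∅).real {ω : BondConfig V | Sep D (cl ω.toFinset a) b c ∧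
          Sep D (cl ω.toFinset b) a c ∧ Sep D (cl ω.toFinset c) a b} *
        (rcMeasureW w q ∅).real {ω : BondConfig V | Sep D (cl ω.toFinset a) b c ∧
          ¬ Sep D (cl ω.toFinset b) a c ∧ ¬ Sep D (cl ω.toFinset c) a b} ≤
      (rcMeasureW w q ∅).real {ω : BondConfig V | Sep D (cl ω.toFinset a) b c ∧
          ¬ Sep D (cl ω.toFinset b) a c ∧ Sep D (cl ω.toFinset c) a b} *
        (rcMeasureW w q ∅).real {ω : BondConfig V | Sep D (cl ω.toFinset a) b c ∧
          Sep D (cl ω.toFinset b) a c ∧ ¬ Sep D (cl ω.toFinset c) a b})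
    (hR1b : (rcMeasureW w q ∅).real {ω : BondConfig V | Sep D (cl ω.toFinset a) b c ∧
          Sep D (cl ω.toFinset b) a c ∧ Sep D (cl ω.toFinset c) a b} *
        (rcMeasureW w q ∅).real {ω : BondConfig V | ¬ Sep D (cl ω.toFinset a) b c ∧
          Sep D (cl ω.toFinset b) a c ∧ ¬ Sep D (cl ω.toFinset c) a b} ≤
      (rcMeasureW w q ∅).real {ω : BondConfig V | ¬ Sep D (cl ω.toFinset a) b c ∧
          Sep D (cl ω.toFinset b) a c ∧ Sep D (cl ω.toFinset c) a b} *
        (rcMeasureW w q ∅).real {ω : BondConfig V | Sep D (cl ω.toFinset a) b c ∧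
          Sep D (cl ω.toFinset b) a c ∧ ¬ Sep D (cl ω.toFinset c) a b}) :
    (rcMeasureW w q ∅).real {ω : BondConfig V | ¬ Sep D (cl ω.toFinset b) a c ∧ ¬ Sep D (cl ω.toFinset c) a b} *
      (rcMeasureW w q ∅).real {ω : BondConfig V | ¬ Sep D (cl ω.toFinset a) b c ∧ ¬ Sep D (cl ω.toFinset c) a b} ≤
    (rcMeasureW w q ∅).real {ω : BondConfig V | ¬ Sep D (cl ω.toFinset c) a b} *
      (rcMeasureW w q ∅).real {ω : BondConfig V | ¬ Sep D (cl ω.toFinset a) b c ∧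
        ¬ Sep D (cl ω.toFinset b) a c ∧ ¬ Sep D (cl ω.toFinset c) a b} := by
  have hq0 : 0 < q := one_pos.trans_le hq
  haveI := isProbabilityMeasure_rcMeasureW w hq0 ∅
  have d := r3_of_r1_rcMeasureW D w hq a b c hR1a hR1b
  set μ := rcMeasureW w q ∅ with hμ
  set Ka : Set (BondConfig V) := {ω | ¬ Sep D (cl ω.toFinset a) b c} with hKa
  set Kb : Set (BondConfig V) := {ω | ¬ Sep D (cl ω.toFinset b) a c} with hKb
  set Kc : Set (BondConfig V) := {ω | ¬ Sep D (cl ω.toFinset c) a b} with hKc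
  have e1 : {ω : BondConfig V | Sep D (cl ω.toFinset a) b c ∧ ¬ Sep D (cl ω.toFinset b) a c ∧
      ¬ Sep D (cl ω.toFinset c) a b} = Kb ∩ Kc ∩ Kaᶜ := by
    ext ω; simp only [Set.mem_inter_iff, Set.mem_compl_iff, hKa, hKb, hKc, Set.mem_setOf_eq, not_not]; tauto
  have e2 : {ω : BondConfig V | ¬ Sep D (cl ω.toFinset a) b c ∧ Sep D (cl ω.toFinset b) a c ∧
      ¬ Sep D (cl ω.toFinset c) a b} = Ka ∩ Kc ∩ Kbᶜ := by
    ext ω; simp only [Set.mem_inter_iff, Set.mem_compl_iff, hKa, hKb, hKc, Set.mem_setOf_eq, not_not]; tauto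
  have e3 : {ω : BondConfig V | Sep D (cl ω.toFinset a) b c ∧ Sep D (cl ω.toFinset b) a c ∧
      ¬ Sep D (cl ω.toFinset c) a b} = Kc ∩ Kaᶜ ∩ Kbᶜ := by
    ext ω; simp only [Set.mem_inter_iff, Set.mem_compl_iff, hKa, hKb, hKc, Set.mem_setOf_eq, not_not]; tauto
  have e4 : {ω : BondConfig V | ¬ Sep D (cl ω.toFinset a) b c ∧ ¬ Sep D (cl ω.toFinset b) a c ∧
      ¬ Sep D (cl ω.toFinset c) a b} = Kb ∩ Kc ∩ Ka := by
    ext ω; simp only [Set.mem_inter_iff, hKa, hKb, hKc, Set.mem_setOf_eq]; tauto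
  have e5 : {ω : BondConfig V | ¬ Sep D (cl ω.toFinset b) a c ∧ ¬ Sep D (cl ω.toFinset c) a b} = Kb ∩ Kc := by
    ext ω; simp only [Set.mem_inter_iff, hKb, hKc, Set.mem_setOf_eq]
  have e6 : {ω : BondConfig V | ¬ Sep D (cl ω.toFinset a) b c ∧ ¬ Sep D (cl ω.toFinset c) a b} = Ka ∩ Kc := by
    ext ω; simp only [Set.mem_inter_iff, hKa, hKc, Set.mem_setOf_eq]
  rw [e1, e2, e3, e4] at d
  rw [e5, e6, e4]
  -- additivity
  have s1 := KNGoodTwoMark.real_split μ (Kb ∩ Kc) Ka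
  have s2 := KNGoodTwoMark.real_split μ (Ka ∩ Kc) Kb
  have s3 : μ.real Kc = μ.real (Kb ∩ Kc ∩ Ka) + μ.real (Kb ∩ Kc ∩ Kaᶜ) +
      (μ.real (Ka ∩ Kc ∩ Kbᶜ) + μ.real (Kc ∩ Kaᶜ ∩ Kbᶜ)) := by
    rw [KNGoodTwoMark.real_split μ Kc Kb, KNGoodTwoMark.real_split μ (Kc ∩ Kb) Ka,
      KNGoodTwoMark.real_split μ (Kc ∩ Kbᶜ) Ka]
    have f1 : Kc ∩ Kb ∩ Ka = Kb ∩ Kc ∩ Ka := by ext ω; simp only [Set.mem_inter_iff]; tauto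
    have f2 : Kc ∩ Kb ∩ Kaᶜ = Kb ∩ Kc ∩ Kaᶜ := by ext ω; simp only [Set.mem_inter_iff]; tauto
    have f3 : Kc ∩ Kbᶜ ∩ Ka = Ka ∩ Kc ∩ Kbᶜ := by ext ω; simp only [Set.mem_inter_iff]; tauto
    have f4 : Kc ∩ Kbᶜ ∩ Kaᶜ = Kc ∩ Kaᶜ ∩ Kbᶜ := by ext ω; simp only [Set.mem_inter_iff]; tauto
    rw [f1, f2, f3, f4]
  have f5 : Ka ∩ Kc ∩ Kb = Kb ∩ Kc ∩ Ka := by ext ω; simp only [Set.mem_inter_iff]; tauto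
  rw [f5] at s2
  rw [s1, s2, s3]
  nlinarith [d, measureReal_nonneg (μ := μ) (s := Kb ∩ Kc ∩ Ka),
    measureReal_nonneg (μ := μ) (s := Kb ∩ Kc ∩ Kaᶜ), measureReal_nonneg (μ := μ) (s := Ka ∩ Kc ∩ Kbᶜ),
    measureReal_nonneg (μ := μ) (s := Kc ∩ Kaᶜ ∩ Kbᶜ)]

/-! ### R4⁺ from R1 (one apex), for `φ_{𝐩,q}`, `q ≥ 1` -/

/-- **R4⁺ ⟸ R1 for the random-cluster measure, every `q ≥ 1`.**  For `φ = rcMeasureW w q ∅`: if R1 holds at `a`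
(`φ(T)·φ(S_a) ≤ φ(U_b)·φ(U_c)` in the atoms of the separation events) then
`φ(S_a)·(φ(U_a) + φ(S_c)) ≤ φ(U_b)·(φ(B_0) + φ(S_b))` (R4⁺).  PROOF: the chain `dualRowR4_real` of part VII —
`P(K_c | K_b ¬K_a) ≤ P(K_c | ¬K_a) ≤ P(K_c) ≤ P(K_c | K_a)` with `K_x = ¬Sep_x`; the first step is R1 at `a` in conditional form, the
other two FKG. [this work] -/
theorem r4plus_of_r1_rcMeasureW (D : Finset (Sym2 V)) (w : Sym2 V → unitInterval) {q : ℝ} (hq : 1 ≤ q) (a b c : V)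
    (hR1a : (rcMeasureW w q ∅).real {ω : BondConfig V | Sep D (cl ω.toFinset a) b c ∧
          Sep D (cl ω.toFinset b) a c ∧ Sep D (cl ω.toFinset c) a b} *
        (rcMeasureW w q ∅).real {ω : BondConfig V | Sep D (cl ω.toFinset a) b c ∧
          ¬ Sep D (cl ω.toFinset b) a c ∧ ¬ Sep D (cl ω.toFinset c) a b} ≤
      (rcMeasureW w q ∅).real {ω : BondConfig V | Sep D (cl ω.toFinset a) b c ∧
          ¬ Sep D (cl ω.toFinset b) a c ∧ Sep D (cl ω.toFinset c) a b} *
        (rcMeasureW w q ∅).real {ω : BondConfig V | Sep D (cl ω.toFinset a) b c ∧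
          Sep D (cl ω.toFinset b) a c ∧ ¬ Sep D (cl ω.toFinset c) a b}) :
    (rcMeasureW w q ∅).real {ω : BondConfig V | Sep D (cl ω.toFinset a) b c ∧
        ¬ Sep D (cl ω.toFinset b) a c ∧ ¬ Sep D (cl ω.toFinset c) a b} *
      ((rcMeasureW w q ∅).real {ω : BondConfig V | ¬ Sep D (cl ω.toFinset a) b c ∧
          Sep D (cl ω.toFinset b) a c ∧ Sep D (cl ω.toFinset c) a b} +
        (rcMeasureW w q ∅).real {ω : BondConfig V | ¬ Sep D (cl ω.toFinset a) b c ∧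
          ¬ Sep D (cl ω.toFinset b) a c ∧ Sep D (cl ω.toFinset c) a b}) ≤
    (rcMeasureW w q ∅).real {ω : BondConfig V | Sep D (cl ω.toFinset a) b c ∧
        ¬ Sep D (cl ω.toFinset b) a c ∧ Sep D (cl ω.toFinset c) a b} *
      ((rcMeasureW w q ∅).real {ω : BondConfig V | ¬ Sep D (cl ω.toFinset a) b c ∧
          ¬ Sep D (cl ω.toFinset b) a c ∧ ¬ Sep D (cl ω.toFinset c) a b} +
        (rcMeasureW w q ∅).real {ω : BondConfig V | ¬ Sep D (cl ω.toFinset a) b c ∧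
          Sep D (cl ω.toFinset b) a c ∧ ¬ Sep D (cl ω.toFinset c) a b}) := by
  have hq0 : 0 < q := one_pos.trans_le hq
  haveI := isProbabilityMeasure_rcMeasureW w hq0 ∅
  obtain ⟨-, hH2, -, hH3⟩ := sepDual_inputs_rcMeasureW D w hq a b c
  set μ := rcMeasureW w q ∅ with hμ
  set Ka : Set (BondConfig V) := {ω | ¬ Sep D (cl ω.toFinset a) b c} with hKa
  set Kb : Set (BondConfig V) := {ω | ¬ Sep D (cl ω.toFinset b) a c} with hKb
  set Kc : Set (BondConfig V) := {ω | ¬ Sep D (cl ω.toFinset c) a b} with hKc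
  -- additivity over the atoms
  have sA : μ.real Ka = μ.real (Ka ∩ Kb ∩ Kc) + μ.real (Ka ∩ Kb ∩ Kcᶜ) +
      (μ.real (Ka ∩ Kbᶜ ∩ Kc) + μ.real (Ka ∩ Kbᶜ ∩ Kcᶜ)) := by
    rw [KNGoodTwoMark.real_split μ Ka Kb, KNGoodTwoMark.real_split μ (Ka ∩ Kb) Kc,
      KNGoodTwoMark.real_split μ (Ka ∩ Kbᶜ) Kc]
  have sAc : μ.real Kaᶜ = μ.real (Kaᶜ ∩ Kb ∩ Kc) + μ.real (Kaᶜ ∩ Kb ∩ Kcᶜ) +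
      (μ.real (Kaᶜ ∩ Kbᶜ ∩ Kc) + μ.real (Kaᶜ ∩ Kbᶜ ∩ Kcᶜ)) := by
    rw [KNGoodTwoMark.real_split μ Kaᶜ Kb, KNGoodTwoMark.real_split μ (Kaᶜ ∩ Kb) Kc,
      KNGoodTwoMark.real_split μ (Kaᶜ ∩ Kbᶜ) Kc]
  have sAC : μ.real (Ka ∩ Kc) = μ.real (Ka ∩ Kb ∩ Kc) + μ.real (Ka ∩ Kbᶜ ∩ Kc) := by
    rw [KNGoodTwoMark.real_split μ (Ka ∩ Kc) Kb]
    have e1 : Ka ∩ Kc ∩ Kb = Ka ∩ Kb ∩ Kc := by ext ω; simp only [Set.mem_inter_iff]; tauto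
    have e2 : Ka ∩ Kc ∩ Kbᶜ = Ka ∩ Kbᶜ ∩ Kc := by ext ω; simp only [Set.mem_inter_iff]; tauto
    rw [e1, e2]
  have sCAc : μ.real (Kc ∩ Kaᶜ) = μ.real (Kaᶜ ∩ Kb ∩ Kc) + μ.real (Kaᶜ ∩ Kbᶜ ∩ Kc) := by
    rw [KNGoodTwoMark.real_split μ (Kc ∩ Kaᶜ) Kb]
    have e1 : Kc ∩ Kaᶜ ∩ Kb = Kaᶜ ∩ Kb ∩ Kc := by ext ω; simp only [Set.mem_inter_iff]; tauto
    have e2 : Kc ∩ Kaᶜ ∩ Kbᶜ = Kaᶜ ∩ Kbᶜ ∩ Kc := by ext ω; simp only [Set.mem_inter_iff]; tauto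
    rw [e1, e2]
  rw [sCAc, sAc] at hH2
  rw [sA, sAC] at hH3
  -- the statement's events as atoms
  have eT : {ω : BondConfig V | Sep D (cl ω.toFinset a) b c ∧ Sep D (cl ω.toFinset b) a c ∧
      Sep D (cl ω.toFinset c) a b} = Kaᶜ ∩ Kbᶜ ∩ Kcᶜ := by
    ext ω; simp only [Set.mem_inter_iff, Set.mem_compl_iff, hKa, hKb, hKc, Set.mem_setOf_eq, not_not]; tauto
  have eSa : {ω : BondConfig V | Sep D (cl ω.toFinset a) b c ∧ ¬ Sep D (cl ω.toFinset b) a c ∧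
      ¬ Sep D (cl ω.toFinset c) a b} = Kaᶜ ∩ Kb ∩ Kc := by
    ext ω; simp only [Set.mem_inter_iff, Set.mem_compl_iff, hKa, hKb, hKc, Set.mem_setOf_eq, not_not]; tauto
  have eSb : {ω : BondConfig V | ¬ Sep D (cl ω.toFinset a) b c ∧ Sep D (cl ω.toFinset b) a c ∧
      ¬ Sep D (cl ω.toFinset c) a b} = Ka ∩ Kbᶜ ∩ Kc := by
    ext ω; simp only [Set.mem_inter_iff, Set.mem_compl_iff, hKa, hKb, hKc, Set.mem_setOf_eq, not_not]; tauto
  have eSc : {ω : BondConfig V | ¬ Sep D (cl ω.toFinset a) b c ∧ ¬ Sep D (cl ω.toFinset b) a c ∧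
      Sep D (cl ω.toFinset c) a b} = Ka ∩ Kb ∩ Kcᶜ := by
    ext ω; simp only [Set.mem_inter_iff, Set.mem_compl_iff, hKa, hKb, hKc, Set.mem_setOf_eq, not_not]; tauto
  have eUa : {ω : BondConfig V | ¬ Sep D (cl ω.toFinset a) b c ∧ Sep D (cl ω.toFinset b) a c ∧
      Sep D (cl ω.toFinset c) a b} = Ka ∩ Kbᶜ ∩ Kcᶜ := by
    ext ω; simp only [Set.mem_inter_iff, Set.mem_compl_iff, hKa, hKb, hKc, Set.mem_setOf_eq, not_not]; tauto
  have eUb : {ω : BondConfig V | Sep D (cl ω.toFinset a) b c ∧ ¬ Sep D (cl ω.toFinset b) a c ∧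
      Sep D (cl ω.toFinset c) a b} = Kaᶜ ∩ Kb ∩ Kcᶜ := by
    ext ω; simp only [Set.mem_inter_iff, Set.mem_compl_iff, hKa, hKb, hKc, Set.mem_setOf_eq, not_not]; tauto
  have eUc : {ω : BondConfig V | Sep D (cl ω.toFinset a) b c ∧ Sep D (cl ω.toFinset b) a c ∧
      ¬ Sep D (cl ω.toFinset c) a b} = Kaᶜ ∩ Kbᶜ ∩ Kc := by
    ext ω; simp only [Set.mem_inter_iff, Set.mem_compl_iff, hKa, hKb, hKc, Set.mem_setOf_eq, not_not]; tauto
  have eB0 : {ω : BondConfig V | ¬ Sep D (cl ω.toFinset a) b c ∧ ¬ Sep D (cl ω.toFinset b) a c ∧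
      ¬ Sep D (cl ω.toFinset c) a b} = Ka ∩ Kb ∩ Kc := by
    ext ω; simp only [Set.mem_inter_iff, hKa, hKb, hKc, Set.mem_setOf_eq]; tauto
  rw [eT, eSa, eUb, eUc] at hR1a
  rw [eSa, eUa, eSc, eUb, eB0, eSb]
  exact dualRowR4_real (q := μ.real (Kaᶜ ∩ Kbᶜ ∩ Kcᶜ)) (ua := μ.real (Ka ∩ Kbᶜ ∩ Kcᶜ))
    (ub := μ.real (Kaᶜ ∩ Kb ∩ Kcᶜ)) (uc := μ.real (Kaᶜ ∩ Kbᶜ ∩ Kc)) (Ta := μ.real (Kaᶜ ∩ Kb ∩ Kc))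
    (Tb := μ.real (Ka ∩ Kbᶜ ∩ Kc)) (Tc := μ.real (Ka ∩ Kb ∩ Kcᶜ)) (T0 := μ.real (Ka ∩ Kb ∩ Kc))
    (w := μ.real Kc)
    (nβ := μ.real (Kaᶜ ∩ Kbᶜ ∩ Kcᶜ) + μ.real (Kaᶜ ∩ Kb ∩ Kcᶜ) + μ.real (Kaᶜ ∩ Kbᶜ ∩ Kc) +
      μ.real (Kaᶜ ∩ Kb ∩ Kc))
    (Pβ := μ.real (Ka ∩ Kbᶜ ∩ Kcᶜ) + μ.real (Ka ∩ Kbᶜ ∩ Kc) + μ.real (Ka ∩ Kb ∩ Kcᶜ) +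
      μ.real (Ka ∩ Kb ∩ Kc))
    measureReal_nonneg measureReal_nonneg measureReal_nonneg measureReal_nonneg measureReal_nonneg
    measureReal_nonneg measureReal_nonneg measureReal_nonneg hR1a rfl rfl
    (by linarith [hH2]) (by linarith [hH3])

end SepDual

end Summit.CriticalPhenomena.PercolationContinuityZ3.Theorems

end
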